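import Summits.Parity.BatemanHorn.Theorems.AlmostPrimeZerosSystemLSDRealSegmentNairWeights
import HarnessLib

/-!
# Nair–Tenenbaum light, VI: Shiu's cut of the value at `√N` and the analytic bookkeeping

Crux `SystemLSDRealSegment` (stmt-Parity-11292, route `AlmostPrimeZeros`), line `beta-thinned-root-kernel`,
support programme of the lead c8: **Nair–Tenenbaum "light"** — the sharp-order upper bound
`Σ_{1≤n≤N} G(F(n)) ≤ C · N · exp(Σ_{p≤N} (G(p) − 1) ρ_F(p)/p)` for a polynomial `F ∈ ℤ[X]` (degree `≥ 1`, positive on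
`ℕ_{≥1}`, root counts `ρ_F(p) ≤ D`, `ρ_F(p) < p`, `ρ_F(p^a) ≤ M`) and every weight `G ≥ 0`, `G(1) = 1`, multiplicative on
coprime arguments with `G(p^v) ≤ A` (M. Nair, Acta Arith. 62 (1992); Nair–Tenenbaum, Acta Math. 180 (1998), Thm 1 —
the special case of the class bounded at prime powers), by Shiu's method (J. reine angew. Math. 313 (1980), §5) run on the
values `m = F(n)`: cut `m = c·d` at `√N` (`Shiu.cutPrime/cPart/dPart`), four classes, the beta upper-bound sieve of dimension
`2D` on the root classes of `c`, Hall–Tenenbaum's Theorem 01 and Rankin's trick with a uniform exponent for the `c`-sums.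
Applied (file `…NairUpperBound`) to the product polynomial of a Bateman–Horn system with `G = y^{capped}` it gives
`Σ_{n≤x} y^{s_f(n)} ≪ x (log x)^{k(y−1)}`, i.e. `H_x(y) = O(1)` on the real segment — the upper half of the order of
magnitude predicted by the crux (lower half: `sumPowStat_lower_bound`, landed).  Everything here is PROVED; no definitions.

This file: the cut data `(P, c, d)` of `m = F(n)`, the weight split `G(m) ≤ G(c)A^{log m/log P}`, the large-prime-power count, and small analytic helpers (`log log x ≤ ε log x − 1 − log ε`, the global weight bound `G(F(n)) ≤ C_g N^{1/24}`).
-/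

open Finset Real Polynomial

namespace Summit.Parity.BatemanHorn.Cruxes.SystemLSDRealSegment.BetaThinnedRootKernel.Nair

open Literature.NumberTheory.Sieve

noncomputable section

/-! ## Part D. Shiu's cut of the value `m = F(n)` at `Z = √N` and the four classes -/

section Cut

variable {F : ℤ[X]} {G : ℕ → ℝ} {A : ℝ}

/-- **The cut data of a value.** For `m ≥ 2` and `1 ≤ Z < m`, with `P = cutPrime Z m`, `c = cPart Z m`,
`d = dPart Z m`: `P` is a prime factor of `m`, `c ≤ Z < c · P^{v_P(m)}`, `c d = m`, `(c, d) = 1`, the prime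
factors of `c` are `< P`, those of `d` are `≥ P`, and every prime `p < P` dividing `m` divides `c`.
[cite: Shiu1980, §5] -/
theorem cut_facts {m : ℕ} (hm : 2 ≤ m) {Z : ℝ} (hZ : 1 ≤ Z) (hZm : Z < m) :
    Shiu.cutPrime Z m ∈ m.primeFactors ∧ (Shiu.cPart Z m : ℝ) ≤ Z ∧
      Z < (Shiu.cPart Z m : ℝ) * (Shiu.cutPrime Z m : ℝ) ^ m.factorization (Shiu.cutPrime Z m) ∧
      Shiu.cPart Z m * Shiu.dPart Z m = m ∧ (Shiu.cPart Z m).Coprime (Shiu.dPart Z m) ∧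
      (∀ p ∈ (Shiu.cPart Z m).primeFactors, p < Shiu.cutPrime Z m) ∧
      (∀ p ∈ (Shiu.dPart Z m).primeFactors, Shiu.cutPrime Z m ≤ p) ∧
      (∀ p : ℕ, p.Prime → p < Shiu.cutPrime Z m → p ∣ m → p ∣ Shiu.cPart Z m) := by
  have hm0 : m ≠ 0 := by omega
  obtain ⟨hP, hcZ⟩ := Shiu.cutPrime_mem hm hZ
  refine ⟨hP, hcZ, Shiu.lt_cPart_mul_pow hm hZ hZm, Shiu.cPart_mul_dPart hm0,
    Shiu.coprime_cPart_dPart hm0, fun p hp => Shiu.lt_of_mem_primeFactors_cPart hp,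
    fun p hp => Shiu.cutPrime_le_of_mem_primeFactors_dPart hm0 hp, fun p hp hlt hdvd => ?_⟩
  show p ∣ smoothPart (Shiu.cutPrime Z m) m
  exact (prime_dvd_smoothPart_iff hp hlt hm0).2 hdvd

/-- **Weight split along the cut.** `G(m) ≤ G(c) · A^{log m/log P}` (`Ω(d) ≤ log m/log P` since every prime factor
of `d` is `≥ P`). [folklore] -/
theorem weight_cut_le (hG0 : ∀ n, 0 ≤ G n) (hG1 : G 1 = 1)
    (hGmul : ∀ m n : ℕ, m.Coprime n → G (m * n) = G m * G n)
    (hGA : ∀ p : ℕ, p.Prime → ∀ v : ℕ, 1 ≤ v → G (p ^ v) ≤ A) (hA : 1 ≤ A)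
    {m : ℕ} (hm : 2 ≤ m) {Z : ℝ} (hZ : 1 ≤ Z) (hZm : Z < m) :
    G m ≤ G (Shiu.cPart Z m) * A ^ (Real.log m / Real.log (Shiu.cutPrime Z m)) := by
  have hm0 : m ≠ 0 := by omega
  obtain ⟨hP, -, -, hcd, hcop, -, hdP, -⟩ := cut_facts hm hZ hZm
  have hPprime : (Shiu.cutPrime Z m).Prime := Nat.prime_of_mem_primeFactors hP
  have hd0 : Shiu.dPart Z m ≠ 0 := Shiu.dPart_ne_zero hm0
  have h1 : G m ≤ G (Shiu.cPart Z m) * A ^ Shiu.bigOmega (Shiu.dPart Z m) := by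
    conv_lhs => rw [← hcd]
    exact weight_mul_le hG0 hG1 hGmul hGA hA hcop hd0
  have hP1 : (1 : ℝ) < (Shiu.cutPrime Z m : ℝ) := by exact_mod_cast hPprime.one_lt
  have hdm : (Shiu.dPart Z m : ℝ) ≤ (m : ℝ) := by
    exact_mod_cast Nat.le_of_dvd (by omega) (Dvd.intro_left _ hcd)
  have hΩ : (Shiu.bigOmega (Shiu.dPart Z m) : ℝ) ≤ Real.log m / Real.log (Shiu.cutPrime Z m) :=
    Shiu.bigOmega_le_div_log hd0 hP1 (fun p hp => by exact_mod_cast hdP p hp) hdm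
  have h2 : A ^ Shiu.bigOmega (Shiu.dPart Z m) ≤ A ^ (Real.log m / Real.log (Shiu.cutPrime Z m)) := by
    rw [← Real.rpow_natCast]
    exact Real.rpow_le_rpow_of_exponent_le hA hΩ
  exact h1.trans (mul_le_mul_of_nonneg_left h2 (hG0 _))

/-- **Class II count** (a large power of a small prime divides the value): for a prime `p` and `1 ≤ T`, with
`a = ⌊log T/log p⌋ + 1` (`p^{a−1} ≤ T < p^a`),
`#{1 ≤ n ≤ N : p^a ∣ F(n)} ≤ ρ(p^a) (N/p^a + 1) ≤ M (N/T + 1)`. [folklore] -/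
theorem card_largePrimePower_le {M : ℕ} (hM : ∀ p : ℕ, p.Prime → ∀ a : ℕ, 1 ≤ a → polyRootCountMod ![F] (p ^ a) ≤ M)
    {p : ℕ} (hp : p.Prime) {T : ℝ} (hT : 1 ≤ T) (N : ℕ) :
    (#((Icc 1 N).filter fun n : ℕ =>
        ((p : ℤ) ^ (⌊Real.log T / Real.log p⌋₊ + 1)) ∣ F.eval (n : ℤ)) : ℝ) ≤ M * (N / T + 1) := by
  set a : ℕ := ⌊Real.log T / Real.log p⌋₊ + 1 with ha
  have ha1 : 1 ≤ a := Nat.le_add_left 1 _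
  have hp2 : (2 : ℝ) ≤ (p : ℝ) := by exact_mod_cast hp.two_le
  have hlogp : 0 < Real.log p := Real.log_pos (by linarith)
  have hT0 : 0 < T := by linarith
  have hq0 : 0 < p ^ a := pow_pos hp.pos a
  -- `T < p ^ a`
  have hTq : T < ((p ^ a : ℕ) : ℝ) := by
    rw [Nat.cast_pow, ← Real.log_lt_log_iff hT0 (by positivity), Real.log_pow,
      ← div_lt_iff₀ hlogp, ha]
    push_cast
    exact Nat.lt_floor_add_one _
  -- the set, over `Ioc 0 N` and with modulus `p ^ a : ℕ`
  have hset : ((Icc 1 N).filter fun n : ℕ => (p : ℤ) ^ a ∣ F.eval (n : ℤ)) =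
      (Ioc 0 N).filter fun n : ℕ => ((p ^ a : ℕ) : ℤ) ∣ F.eval (n : ℤ) := by
    rw [show Icc 1 N = Ioc 0 N from Finset.Icc_add_one_left_eq_Ioc 0 N, Nat.cast_pow]
  -- each root class modulo `p ^ a` has at most `N / p ^ a + 1` members in `(0, N]`
  have hcount : (#((Ioc 0 N).filter fun n : ℕ => ((p ^ a : ℕ) : ℤ) ∣ F.eval (n : ℤ)) : ℝ) ≤
      polyRootCountMod ![F] (p ^ a) * ((N : ℝ) / ((p ^ a : ℕ) : ℝ) + 1) := by
    rw [card_filter_dvd_eval_eq_sum F (Ioc 0 N) hq0, polyRootCountMod_single, Nat.cast_sum]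
    refine (Finset.sum_le_sum fun s _ => card_apIndex_le hq0 N s).trans ?_
    rw [Finset.sum_const, nsmul_eq_mul]
  have hρ : (polyRootCountMod ![F] (p ^ a) : ℝ) ≤ M := by exact_mod_cast hM p hp a ha1
  have hdiv : (N : ℝ) / ((p ^ a : ℕ) : ℝ) ≤ N / T :=
    div_le_div_of_nonneg_left (Nat.cast_nonneg N) hT0 hTq.le
  rw [hset]
  calc (#((Ioc 0 N).filter fun n : ℕ => ((p ^ a : ℕ) : ℤ) ∣ F.eval (n : ℤ)) : ℝ)
      ≤ polyRootCountMod ![F] (p ^ a) * ((N : ℝ) / ((p ^ a : ℕ) : ℝ) + 1) := hcount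
    _ ≤ M * ((N : ℝ) / T + 1) := mul_le_mul hρ (by linarith) (by positivity) (by positivity)

end Cut

/-! ## Part E. The class estimates and the theorem -/

section Main

variable {F : ℤ[X]} {D M : ℕ} {A : ℝ}

/-! ### Small analytic helpers -/

/-- `log log x ≤ ε log x − 1 − log ε` for `x > 1`, `ε > 0` (from `log s ≤ s − 1`). [folklore] -/
theorem loglog_le_eps {x : ℝ} (hx : 1 < x) {ε : ℝ} (hε : 0 < ε) :
    Real.log (Real.log x) ≤ ε * Real.log x - 1 - Real.log ε := by
  have hlx : 0 < Real.log x := Real.log_pos hx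
  have h1 : Real.log (ε * Real.log x) ≤ ε * Real.log x - 1 := Real.log_le_sub_one_of_pos (by positivity)
  rw [Real.log_mul hε.ne' hlx.ne'] at h1
  linarith

/-- A power of `log N` is eventually below any power of `N`, explicitly: for `N ≥ 2`, `B ≥ 0`, `θ > 0`,
`B · log log N ≤ θ log N + B (log (B/θ + 1))` … in the convenient form
`exp (B log log N) ≤ exp (B log (B/θ + 1)) · N^θ`. [folklore] -/
theorem exp_mul_loglog_le {N : ℝ} (hN : 1 < N) {B θ : ℝ} (hB : 0 ≤ B) (hθ : 0 < θ) :
    Real.exp (B * Real.log (Real.log N)) ≤ Real.exp (B * (Real.log (B / θ + 1))) * N ^ θ := by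
  rcases hB.eq_or_lt with rfl | hB0
  · simp only [zero_mul, Real.exp_zero, one_mul]
    exact Real.one_le_rpow hN.le hθ.le
  · have hε : 0 < θ / B := div_pos hθ hB0
    have h1 := loglog_le_eps hN hε
    have hN0 : 0 < N := by linarith
    rw [Real.rpow_def_of_pos hN0, ← Real.exp_add]
    refine Real.exp_le_exp.2 ?_
    have h2 : B * Real.log (Real.log N) ≤ B * (θ / B * Real.log N - 1 - Real.log (θ / B)) :=
      mul_le_mul_of_nonneg_left h1 hB
    have h3 : B * (θ / B * Real.log N) = θ * Real.log N := by field_simp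
    have h4 : -Real.log (θ / B) = Real.log (B / θ) := by rw [← Real.log_inv, inv_div]
    have h5 : Real.log (B / θ) ≤ Real.log (B / θ + 1) := Real.log_le_log (div_pos hB0 hθ) (by linarith)
    nlinarith [h2, h3, h4, h5, Real.log_nonneg (show (1:ℝ) ≤ B / θ + 1 by
      have := (div_pos hB0 hθ).le; linarith)]

/-- `Σ_{p ≤ N} (G(p) − 1) ρ(p)/p = Σ G ρ/p − Σ ρ/p`. [folklore] -/
theorem sum_sub_one_mul_eq (G : ℕ → ℝ) (F : ℤ[X]) (S : Finset ℕ) :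
    ∑ p ∈ S, (G p - 1) * polyRootCountMod ![F] p / p =
      ∑ p ∈ S, G p * polyRootCountMod ![F] p / p - ∑ p ∈ S, (polyRootCountMod ![F] p : ℝ) / p := by
  rw [← Finset.sum_sub_distrib]
  refine Finset.sum_congr rfl fun p _ => ?_
  ring

/-- Lower bound of the main exponential: `exp(Σ_{p≤N} (G(p)−1)ρ(p)/p) ≥ exp(−D (log log N + 4))` for `G ≥ 0`,
`ρ(p) ≤ D`, `N ≥ 2`. [folklore] -/
theorem exp_neg_le_exp_sum {G : ℕ → ℝ} (hG0 : ∀ n, 0 ≤ G n)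
    (hD : ∀ p : ℕ, p.Prime → polyRootCountMod ![F] p ≤ D) {N : ℕ} (hN : 2 ≤ N) :
    Real.exp (-(D * (Real.log (Real.log N) + 4))) ≤
      Real.exp (∑ p ∈ Nat.primesLE N, (G p - 1) * polyRootCountMod ![F] p / p) := by
  refine Real.exp_le_exp.2 ?_
  have h1 : ∀ p ∈ Nat.primesLE N, -((D : ℝ) * (1 / p)) ≤ (G p - 1) * polyRootCountMod ![F] p / p := by
    intro p hp
    have hpp := (Nat.mem_primesLE.1 hp).2
    have hp0 : (0 : ℝ) < p := by exact_mod_cast hpp.pos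
    have hρ : (polyRootCountMod ![F] p : ℝ) ≤ D := by exact_mod_cast hD p hpp
    have hρ0 : (0 : ℝ) ≤ polyRootCountMod ![F] p := Nat.cast_nonneg _
    rw [mul_one_div, neg_le, ← neg_div, le_div_iff₀ hp0, div_mul_cancel₀ _ hp0.ne']
    have : -((G p - 1) * (polyRootCountMod ![F] p : ℝ)) ≤ 1 * polyRootCountMod ![F] p := by
      nlinarith [hG0 p]
    linarith
  have h2 := Finset.sum_le_sum h1
  have h3 := Literature.NumberTheory.LFunctions.MertensBound.sum_inv_prime_le N hN
  rw [Finset.sum_neg_distrib, ← Finset.mul_sum] at h2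
  have hD0 : (0 : ℝ) ≤ D := Nat.cast_nonneg _
  nlinarith [mul_le_mul_of_nonneg_left h3 hD0]

/-- Sums of `G ρ/p` over fewer primes are smaller (`G ≥ 0`). [folklore] -/
theorem sum_Grho_div_mono {G : ℕ → ℝ} (hG0 : ∀ n, 0 ≤ G n) {S T : Finset ℕ} (hST : S ⊆ T) :
    ∑ p ∈ S, G p * polyRootCountMod ![F] p / p ≤ ∑ p ∈ T, G p * polyRootCountMod ![F] p / p :=
  Finset.sum_le_sum_of_subset_of_nonneg hST fun p _ _ => by
    have := hG0 p; positivity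

/-- `primesBelow ⌈v⌉₊ ⊆ primesLE N` for `v ≤ N`. [folklore] -/
theorem primesBelow_ceil_subset_primesLE {v : ℝ} {N : ℕ} (hv : v ≤ N) :
    Nat.primesBelow ⌈v⌉₊ ⊆ Nat.primesLE N := by
  intro p hp
  rw [Nat.mem_primesBelow] at hp
  rw [Nat.mem_primesLE]
  refine ⟨?_, hp.2⟩
  have h1 : p < ⌈v⌉₊ := hp.1
  have h2 : ⌈v⌉₊ ≤ N := Nat.ceil_le.2 hv
  omega

/-- The coefficient height is `≥ 1` when `deg F ≥ 1`. [folklore] -/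
theorem one_le_height (hd : 1 ≤ F.natDegree) :
    1 ≤ ∑ j ∈ range (F.natDegree + 1), (F.coeff j).natAbs := by
  have hF : F ≠ 0 := by rintro rfl; simp at hd
  have hmem : F.natDegree ∈ range (F.natDegree + 1) := Finset.mem_range.2 (Nat.lt_succ_self _)
  have h1 : (F.coeff F.natDegree).natAbs ≤ ∑ j ∈ range (F.natDegree + 1), (F.coeff j).natAbs :=
    Finset.single_le_sum (f := fun j => (F.coeff j).natAbs) (fun j _ => Nat.zero_le _) hmem
  have h2 : 1 ≤ (F.coeff F.natDegree).natAbs := by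
    rw [Nat.one_le_iff_ne_zero, Int.natAbs_ne_zero, Polynomial.coeff_natDegree]
    exact Polynomial.leadingCoeff_ne_zero.2 hF
  exact h2.trans h1

/-- **Global weight bound on the values**: `G(F(n)) ≤ C_g N^{1/24}` for `1 ≤ n ≤ N` with `F(n) > 0`, uniformly over
the class (`G(m) ≤ C m^{1/(24 d)}` and `F(n) ≤ H (N+1)^d`). [folklore] -/
theorem weight_global_le (hd : 1 ≤ F.natDegree) (hA : 1 ≤ A) :
    ∃ Cg : ℝ, 0 < Cg ∧ ∀ G : ℕ → ℝ, (∀ n, 0 ≤ G n) → G 1 = 1 →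
      (∀ m n : ℕ, m.Coprime n → G (m * n) = G m * G n) →
      (∀ p : ℕ, p.Prime → ∀ v : ℕ, 1 ≤ v → G (p ^ v) ≤ A) →
      ∀ N n : ℕ, 1 ≤ N → n ≤ N → 0 < F.eval (n : ℤ) →
        G (F.eval (n : ℤ)).toNat ≤ Cg * (N : ℝ) ^ (1 / 24 : ℝ) := by
  set d := F.natDegree with hddef
  set H : ℕ := ∑ j ∈ range (F.natDegree + 1), (F.coeff j).natAbs with hH
  have hH1 : 1 ≤ H := one_le_height hd
  have hδ : (0 : ℝ) < 1 / (24 * d) := by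
    have : (1 : ℝ) ≤ d := by exact_mod_cast hd
    positivity
  obtain ⟨Cw, hCw1, hCw⟩ := exists_weight_le_rpow hA hδ
  refine ⟨2 * Cw * (H : ℝ) ^ (1 / (24 * d) : ℝ), by positivity, ?_⟩
  intro G hG0 hG1 hGmul hGA N n hN hn hFn
  set m := (F.eval (n : ℤ)).toNat with hm
  have hm1 : 1 ≤ m := by
    rw [hm, Nat.one_le_iff_ne_zero, Ne, Int.toNat_eq_zero, not_le]; exact hFn
  have hmH : m ≤ H * (N + 1) ^ d := toNat_eval_le_height hn
  have h1 := hCw G hG0 hG1 hGmul hGA m hm1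
  have hd1 : (1 : ℝ) ≤ d := by exact_mod_cast hd
  have hd0 : (0 : ℝ) < d := by linarith
  have hN1 : (1 : ℝ) ≤ N := by exact_mod_cast hN
  -- m^{1/(24d)} ≤ H^{1/(24d)} (N+1)^{1/24} ≤ H^{1/(24d)} · 2 N^{1/24}
  have h2 : (m : ℝ) ^ (1 / (24 * d) : ℝ) ≤ (H : ℝ) ^ (1 / (24 * d) : ℝ) * (2 * (N : ℝ) ^ (1 / 24 : ℝ)) := by
    have hmH' : (m : ℝ) ≤ (H : ℝ) * ((N : ℝ) + 1) ^ (d : ℝ) := by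
      rw [Real.rpow_natCast]; exact_mod_cast hmH
    calc (m : ℝ) ^ (1 / (24 * d) : ℝ) ≤ ((H : ℝ) * ((N : ℝ) + 1) ^ (d : ℝ)) ^ (1 / (24 * d) : ℝ) :=
          Real.rpow_le_rpow (Nat.cast_nonneg _) hmH' hδ.le
      _ = (H : ℝ) ^ (1 / (24 * d) : ℝ) * ((N : ℝ) + 1) ^ (1 / 24 : ℝ) := by
          rw [Real.mul_rpow (Nat.cast_nonneg _) (by positivity), ← Real.rpow_mul (by positivity)]
          congr 2
          field_simp
      _ ≤ (H : ℝ) ^ (1 / (24 * d) : ℝ) * (2 * (N : ℝ) ^ (1 / 24 : ℝ)) := by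
          refine mul_le_mul_of_nonneg_left ?_ (by positivity)
          calc ((N : ℝ) + 1) ^ (1 / 24 : ℝ) ≤ (2 * (N : ℝ)) ^ (1 / 24 : ℝ) :=
                Real.rpow_le_rpow (by positivity) (by linarith) (by norm_num)
            _ = (2 : ℝ) ^ (1 / 24 : ℝ) * (N : ℝ) ^ (1 / 24 : ℝ) := Real.mul_rpow (by norm_num) (by positivity)
            _ ≤ 2 * (N : ℝ) ^ (1 / 24 : ℝ) := by
                refine mul_le_mul_of_nonneg_right ?_ (by positivity)
                calc (2 : ℝ) ^ (1 / 24 : ℝ) ≤ (2 : ℝ) ^ (1 : ℝ) :=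
                      Real.rpow_le_rpow_of_exponent_le (by norm_num) (by norm_num)
                  _ = 2 := Real.rpow_one 2
  calc G m ≤ Cw * (m : ℝ) ^ (1 / (24 * d) : ℝ) := h1
    _ ≤ Cw * ((H : ℝ) ^ (1 / (24 * d) : ℝ) * (2 * (N : ℝ) ^ (1 / 24 : ℝ))) :=
        mul_le_mul_of_nonneg_left h2 (by linarith)
    _ = 2 * Cw * (H : ℝ) ^ (1 / (24 * d) : ℝ) * (N : ℝ) ^ (1 / 24 : ℝ) := by ring

/-- If `√N < m` (with `N ≥ 1`) then `2 ≤ m`, `1 ≤ √N`. [folklore] -/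
theorem two_le_of_sqrt_lt {N m : ℕ} (hN : 1 ≤ N) (h : Real.sqrt N < m) : 2 ≤ m ∧ (1 : ℝ) ≤ Real.sqrt N := by
  have h1 : (1 : ℝ) ≤ Real.sqrt N := by
    rw [Real.one_le_sqrt]; exact_mod_cast hN
  refine ⟨?_, h1⟩
  have : (1 : ℝ) < m := h1.trans_lt h
  exact_mod_cast this

end Main

/-- **Registered form** (`--supports stmt-Parity-11292`): Shiu's cut of the value and the global weight bound `G(F(n)) ≤ C_g N^{1/24}`. [folklore] -/
theorem nair_weight_global_le : ∀ (F : ℤ[X]) (A : ℝ), 1 ≤ F.natDegree → 1 ≤ A → ∃ Cg : ℝ, 0 < Cg ∧ ∀ G : ℕ → ℝ, (∀ n, 0 ≤ G n) → G 1 = 1 → (∀ m n : ℕ, m.Coprime n → G (m * n) = G m * G n) → (∀ p : ℕ, p.Prime → ∀ v : ℕ, 1 ≤ v → G (p ^ v) ≤ A) → ∀ N n : ℕ, 1 ≤ N → n ≤ N → 0 < F.eval (n : ℤ) → G (F.eval (n : ℤ)).toNat ≤ Cg * (N : ℝ) ^ (1 / 24 : ℝ) :=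
  fun _F _A hd hA => weight_global_le hd hA

end

end Summit.Parity.BatemanHorn.Cruxes.SystemLSDRealSegment.BetaThinnedRootKernel.Nair
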